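import Mathlib.Analysis.SpecialFunctions.Pow.NNReal
import Mathlib.Analysis.SpecialFunctions.Log.Base
import Mathlib.Data.Nat.Choose.Dvd
import Literature.AlgebraicGeometry.Frobenioids.PadicLocalDiscreteValuation
import HarnessLib

/-!
# Frobenioids II, Ex. 1.1 (i) / Thm. 1.2 (i): the valuation of a finite extension of `ℚ_p` has rank one;
# the real embedding normalised at `p` (PROOFS)

Mochizuki, *The geometry of Frobenioids II*, Kyushu J. Math. **62** (2008), §1, Ex. 1.1 (i) p. 7 ("`K` a
finite extension of `ℚ_p`") and Thm. 1.2 (i) p. 9. Arithmetic inputs for the `p`-adic topology on `K` and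
on `O_K^×` (`PadicUnitGroupProfinite.lean`, the unit-profinite clause of Thm. 1.2 (i)), in abc-iut-L1-t4's
unbundled setting (`hc`: a finite `ℚ_p`-algebra structure along which the valuative relation of `K`
restricts to the `p`-adic one): the value group of `K` is archimedean ("finite index",
`exists_valuation_pow_factorial_eq_zpow`), so the valuative relation is nontrivial of rank `≤ 1`
(`IsRankLeOne K`), and there is a strictly monotone real embedding of the value group NORMALISED by
`|p| = p⁻¹`, under which `|a| = ‖a‖_p` for `a ∈ ℚ_p` — so that the valuation norm makes `K` a normed
`ℚ_p`-vector space. Also: `v(n) ≤ 1` for `n ∈ ℕ` and `v(binom(p,k)) ≤ v(p)` for `0 < k < p`.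
[cite: MochizukiFrdII2008, Ex 1.1 (i) p.7] PROOF-ONLY file (seat abc-iut-L1-d10); no definitions.
-/

namespace Literature.AlgebraicGeometry.Frobenioids

namespace PadicFrd

open ValuativeRel NNReal

universe u

variable {p : ℕ} [hp : Fact p.Prime] {K : Type u} [Field K] [ValuativeRel K]

section ValuationAlgebra

/-- Natural numbers have valuation `≤ 1`. [cite: MochizukiFrdII2008, Ex 1.1 (i) p.7] -/
theorem valuation_natCast_le_one (n : ℕ) : valuation K (n : K) ≤ 1 := by
  induction n with
  | zero => simp
  | succ n ih =>
    rw [Nat.cast_succ]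
    exact (Valuation.map_add _ _ _).trans (max_le ih (by rw [map_one]))

/-- `v(binom(p,k)) ≤ v(p)` for `0 < k < p` (`p ∣ binom(p,k)`). [cite: MochizukiFrdII2008, Thm 1.2 (i) p.9] -/
theorem valuation_choose_le {k : ℕ} (hk0 : k ≠ 0) (hkp : k < p) :
    valuation K (Nat.choose p k : K) ≤ valuation K (p : K) := by
  obtain ⟨c, hc⟩ := hp.out.dvd_choose_self hk0 hkp
  rw [hc, Nat.cast_mul, map_mul]
  exact mul_le_of_le_one_right' (valuation_natCast_le_one c)

variable [Algebra ℚ_[p] K]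

/-- The valuative relation of a `p`-adic local field is nontrivial (`0 < v(p) < 1`).
[cite: MochizukiFrdII2008, Ex 1.1 (i) p.7] -/
theorem isNontrivial_of_padic
    (hc : ∀ a b : ℚ_[p], algebraMap ℚ_[p] K a ≤ᵥ algebraMap ℚ_[p] K b ↔ a ≤ᵥ b) : IsNontrivial K :=
  ⟨valuation K (p : K), (Valuation.ne_zero_iff _).mpr natCast_p_ne_zero, (valuation_p_lt_one hc).ne⟩

/-- "Finite index of value groups" ⇒ the value group of a finite extension of `ℚ_p` is archimedean.
[cite: MochizukiFrdII2008, Ex 1.1 (i) p.7] -/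
theorem mulArchimedean_valueGroupWithZero [Module.Finite ℚ_[p] K]
    (hc : ∀ a b : ℚ_[p], algebraMap ℚ_[p] K a ≤ᵥ algebraMap ℚ_[p] K b ↔ a ≤ᵥ b) :
    MulArchimedean (ValueGroupWithZero K) := by
  set N := (Module.finrank ℚ_[p] K).factorial with hN
  have hN0 : N ≠ 0 := Nat.factorial_ne_zero _
  have hvp0 : 0 < valuation K (p : K) :=
    zero_lt_iff.mpr ((Valuation.ne_zero_iff _).mpr natCast_p_ne_zero)
  have hvp1 : valuation K (p : K) < 1 := valuation_p_lt_one hc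
  refine ⟨fun x y hy => ?_⟩
  rcases eq_or_ne x 0 with rfl | hx0
  · exact ⟨0, zero_le⟩
  obtain ⟨a, rfl⟩ := valuation_surjective x
  obtain ⟨b, rfl⟩ := valuation_surjective y
  have ha0 : a ≠ 0 := fun h => hx0 (by rw [h, map_zero])
  have hb0 : b ≠ 0 := fun h => by rw [h, map_zero] at hy; exact not_lt_zero hy
  obtain ⟨ka, hka⟩ := exists_valuation_pow_factorial_eq_zpow hc ha0
  obtain ⟨kb, hkb⟩ := exists_valuation_pow_factorial_eq_zpow hc hb0
  rw [← hN] at hka hkb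
  have hkb0 : kb < 0 := by
    have h1 : 1 < valuation K b ^ N := one_lt_pow₀ hy hN0
    rw [hkb] at h1
    by_contra h
    exact absurd h1 (not_lt.mpr (zpow_le_one₀ hvp0 hvp1.le (not_lt.mp h)))
  refine ⟨ka.natAbs, (pow_le_pow_iff_left₀ zero_le zero_le hN0).mp ?_⟩
  rw [← pow_mul, pow_mul', hkb, hka, ← zpow_natCast, ← zpow_mul,
    zpow_le_zpow_iff_right_of_lt_one₀ hvp0 hvp1]
  calc kb * (ka.natAbs : ℤ) ≤ (-1) * (ka.natAbs : ℤ) :=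
        mul_le_mul_of_nonneg_right (by omega) (by positivity)
    _ = -|ka| := by rw [Int.natCast_natAbs, neg_one_mul]
    _ ≤ ka := neg_abs_le ka

/-- Hence the valuative relation of a finite extension of `ℚ_p` has rank `≤ 1`.
[cite: MochizukiFrdII2008, Ex 1.1 (i) p.7] -/
theorem isRankLeOne_of_padic [Module.Finite ℚ_[p] K]
    (hc : ∀ a b : ℚ_[p], algebraMap ℚ_[p] K a ≤ᵥ algebraMap ℚ_[p] K b ↔ a ≤ᵥ b) : IsRankLeOne K :=
  isRankLeOne_iff_mulArchimedean.mpr (mulArchimedean_valueGroupWithZero hc)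

/-- A real embedding of the value group NORMALISED at `p`: `|p| = p⁻¹` (so that the valuation norm on `K`
restricts to the `p`-adic norm of `ℚ_p`). [cite: MochizukiFrdII2008, Ex 1.1 (i) p.7] -/
theorem exists_rankLeOneStruct_normalized [Module.Finite ℚ_[p] K]
    (hc : ∀ a b : ℚ_[p], algebraMap ℚ_[p] K a ≤ᵥ algebraMap ℚ_[p] K b ↔ a ≤ᵥ b) :
    ∃ e : RankLeOneStruct K, e.emb (valuation K (p : K)) = (p : ℝ≥0)⁻¹ := by
  obtain ⟨⟨e₀⟩⟩ := isRankLeOne_of_padic hc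
  have hvp0 : 0 < valuation K (p : K) :=
    zero_lt_iff.mpr ((Valuation.ne_zero_iff _).mpr natCast_p_ne_zero)
  have hvp1 : valuation K (p : K) < 1 := valuation_p_lt_one hc
  set c : ℝ≥0 := e₀.emb (valuation K (p : K)) with hc_def
  have hc0 : 0 < c := by
    have h := e₀.strictMono hvp0
    rwa [map_zero] at h
  have hc1 : c < 1 := by
    have h := e₀.strictMono hvp1
    rwa [map_one] at h
  have hpr : 0 < (p : ℝ) := Nat.cast_pos.mpr hp.out.pos
  have hc0' : 0 < (c : ℝ) := NNReal.coe_pos.mpr hc0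
  have hc1' : (c : ℝ) < 1 := NNReal.coe_lt_one.mpr hc1
  set s : ℝ := Real.logb c (p : ℝ)⁻¹ with hs_def
  have hs : 0 < s := Real.logb_pos_of_base_lt_one hc0' hc1' (inv_pos.mpr hpr)
    (inv_lt_one_of_one_lt₀ (Nat.one_lt_cast.mpr hp.out.one_lt))
  have hcs : (c : ℝ) ^ s = (p : ℝ)⁻¹ := Real.rpow_logb hc0' hc1'.ne (inv_pos.mpr hpr)
  let f : ℝ≥0 →*₀ ℝ≥0 :=
    { toFun := fun x => x ^ s
      map_zero' := NNReal.zero_rpow hs.ne'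
      map_one' := NNReal.one_rpow s
      map_mul' := fun x y => NNReal.mul_rpow }
  have hf : StrictMono f := fun x y h => NNReal.rpow_lt_rpow h hs
  refine ⟨⟨f.comp e₀.emb, hf.comp e₀.strictMono⟩, ?_⟩
  apply NNReal.coe_injective
  change ((c ^ s : ℝ≥0) : ℝ) = _
  rw [NNReal.coe_rpow, hcs, NNReal.coe_inv, NNReal.coe_natCast]

/-- Under the normalised embedding, `|a| = ‖a‖_p` for `a ∈ ℚ_p`. [cite: MochizukiFrdII2008, Ex 1.1 (i) p.7] -/
theorem emb_valuation_algebraMap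
    (hc : ∀ a b : ℚ_[p], algebraMap ℚ_[p] K a ≤ᵥ algebraMap ℚ_[p] K b ↔ a ≤ᵥ b)
    (e : RankLeOneStruct K) (he : e.emb (valuation K (p : K)) = (p : ℝ≥0)⁻¹) (a : ℚ_[p]) :
    ((e.emb (valuation K (algebraMap ℚ_[p] K a)) : ℝ≥0) : ℝ) = ‖a‖ := by
  rcases eq_or_ne a 0 with rfl | ha
  · simp
  rw [valuation_algebraMap_eq_zpow hc ha, map_zpow₀, he, Padic.norm_eq_zpow_neg_valuation ha,
    NNReal.coe_zpow, NNReal.coe_inv, NNReal.coe_natCast, inv_zpow']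

end ValuationAlgebra

end PadicFrd

end Literature.AlgebraicGeometry.Frobenioids
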